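import Mathlib
import Summits.MatrixMultiplication.MatrixMultiplication.Theorems.HiddenToeplitzCornersHiddenCornerLemmaRStein
import Summits.MatrixMultiplication.MatrixMultiplication.Theorems.HiddenToeplitzCornersHiddenCornerLemmaRPhiInjKrylov
import Summits.MatrixMultiplication.MatrixMultiplication.Theorems.HiddenToeplitzCornersHiddenCornerLemmaRPhiInjReduction

/-!
# Reduction of the G-const dual law to the `(2p-1)`-column conjecture PHI-INJ(p), general `p`
# (hidden-corner lemma, crux stmt-MatrixMultiplication-10752)

Support file for crux item `stmt-MatrixMultiplication-10752`
(`Summit.MatrixMultiplication.MatrixMultiplication.Theses.HiddenToeplitzCorners.HiddenCornerLemmaR`),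
line `atkinson-lloyd-core-split`, stub `hclR_gconstDualLaw_of_phiInj`: for every `p`, the G-const
dual law `stub_gconstDualLaw` (conclusion `r ≤ 2 * p`) follows from the hypothesis PHI-INJ(p) —
"for a nonsingular `(2p-1)`-column design of the `p`-generator class, the twisted evaluation maps
`Λ ↦ ∑ c, (∑ j, ((A_k *ᵥ Λᵀ c) j) • (Zᵀ)^j) *ᵥ (Eᵀ c)` (`A_k := ∑ i, G₀ i k • (Zᵀ)^i`) are jointly
surjective onto the twisted evaluations of the Krylov span of the frame".  This is the template
`hclR_gconstDualLaw_p_two_of_phiInj3` (module `…PhiInjReduction`, the case `p = 2`) with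
`3 ↦ 2p - 1` columns.

`Z` is the lower shift on `Fin N → ℂ` written verbatim as in the crux (`Z i j = [i = j + 1]`).

Proof.  If `p = 0` the annihilator hypothesis is unconditional, so every test matrix kills `F`,
whence `F = 0` and `r = rank F = 0`.  If `1 ≤ p`, suppose `2p < r` and put `m := 2p - 1`, so
`1 ≤ m < r`.  By `hclR_phi_column_absorbed` some column `b` of the frame `E` lies in the Krylov
span of `m` other columns `ι 0, …, ι (m-1)` (`ι 0` is a column attaining the largest row index of
a nonzero entry of `E`, `hclR_phi_top_column`).  The sub-design on these columns
(`E.submatrix id ι`, `M * E.submatrix id ι`, `X₀ := 1`) is again nonsingular of rank `m`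
(`Matrix.rank_mul_eq_right_of_isUnit_det`) and inherits the annihilator hypothesis (extend an
`m`-column test matrix by zero, `hclR_phi_sum_extend_fin`).  PHI-INJ(p) then produces, for every
`μ`, an `m`-column test matrix `Λ` whose twisted evaluation equals that of `μ` against column `b`;
the test matrix "`Λ` on the columns `ι`, `-μ` on column `b`" is annihilated, so the annihilator
hypothesis gives `μᵀ F = 0` for every `μ`, i.e. `F = 0`, contradicting `rank F = r ≥ 1`.

* `hclR_phi_T_sum` — the twisted evaluation of a finite sum of test columns;
* `hclR_phi_sum_extend_fin` — column sums of twisted evaluations of an `m`-column test matrix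
  extended by zero along `ι : Fin m → Fin r` (the `m`-ary `hclR_phi_sum_extend`);
* `hclR_phi_fin_avoiding`, `hclR_phi_column_absorbed` — for `0 < m < r`, some column `b` of `E`
  lies in the Krylov span of `m` other columns (the `m`-ary `hclR_column_absorbed`);
* `hclR_gconstDualLaw_of_phiInj` — the registered statement.
-/

set_option linter.dupNamespace false

namespace Summit.MatrixMultiplication.MatrixMultiplication.Theorems

open Matrix BigOperators Finset

/-- The twisted evaluation `x ↦ (∑ j, ((A *ᵥ x) j) • (Zᵀ)^j) *ᵥ e` of a finite sum of test
columns is the sum of the twisted evaluations. -/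
theorem hclR_phi_T_sum {N : ℕ} {α : Type*} (s : Finset α) (A : Matrix (Fin N) (Fin N) ℂ)
    (x : α → Fin N → ℂ) (e : Fin N → ℂ) :
    (∑ j : Fin N, ((A *ᵥ (∑ a ∈ s, x a)) j) •
        (Matrix.of fun i j : Fin N => if (i : ℕ) = (j : ℕ) + 1 then (1 : ℂ) else 0)ᵀ ^ (j : ℕ)) *ᵥ e =
      ∑ a ∈ s, (∑ j : Fin N, ((A *ᵥ (x a)) j) •
        (Matrix.of fun i j : Fin N => if (i : ℕ) = (j : ℕ) + 1 then (1 : ℂ) else 0)ᵀ ^ (j : ℕ)) *ᵥ e := by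
  classical
  induction s using Finset.induction_on with
  | empty => rw [Finset.sum_empty, Finset.sum_empty, hclR_phi_T_zero]
  | insert a s ha ih => rw [Finset.sum_insert ha, Finset.sum_insert ha, hclR_phi_T_add, ih]

/-- Extension by zero along `ι : Fin m → Fin r`: the column sum of twisted evaluations of the
extended test matrix `Λ n c := ∑ i, [ι i = c] L n i` against the frame columns `G c` is the
`m`-term sum against the columns `G (ι i)` (the `m`-ary `hclR_phi_sum_extend`). -/
theorem hclR_phi_sum_extend_fin {N r m : ℕ} (ι : Fin m → Fin r) (A : Matrix (Fin N) (Fin N) ℂ)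
    (G : Fin r → Fin N → ℂ) (L : Matrix (Fin N) (Fin m) ℂ) :
    ∑ c : Fin r, (∑ j : Fin N,
        ((A *ᵥ ((Matrix.of fun (n : Fin N) (c : Fin r) =>
            ∑ i : Fin m, if ι i = c then L n i else 0)ᵀ c)) j) •
          (Matrix.of fun i j : Fin N => if (i : ℕ) = (j : ℕ) + 1 then (1 : ℂ) else 0)ᵀ ^ (j : ℕ)) *ᵥ
        (G c) =
      ∑ i : Fin m, (∑ j : Fin N, ((A *ᵥ (Lᵀ i)) j) •
          (Matrix.of fun i j : Fin N => if (i : ℕ) = (j : ℕ) + 1 then (1 : ℂ) else 0)ᵀ ^ (j : ℕ)) *ᵥ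
        (G (ι i)) := by
  have hcol : ∀ c : Fin r, (Matrix.of fun (n : Fin N) (c : Fin r) =>
      ∑ i : Fin m, if ι i = c then L n i else 0)ᵀ c =
      ∑ i : Fin m, if ι i = c then Lᵀ i else 0 := by
    intro c
    funext n
    simp only [Matrix.transpose_apply, Matrix.of_apply, Finset.sum_apply, ite_apply, Pi.zero_apply]
  simp_rw [hcol, hclR_phi_T_sum, hclR_phi_T_ite]
  rw [Finset.sum_comm]
  simp_rw [Finset.sum_ite_eq, Finset.mem_univ, if_true]

/-- For `0 < m < r` and `c : Fin r` there are an index `b` and an injective `ι : Fin m → Fin r`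
avoiding `b` with `ι 0 = c` (transport `i ↦ i` and `b := m` along the swap `0 ↔ c`). -/
theorem hclR_phi_fin_avoiding {r m : ℕ} (hm : 0 < m) (hr : m < r) (c : Fin r) :
    ∃ (b : Fin r) (ι : Fin m → Fin r), Function.Injective ι ∧ (∀ i : Fin m, ι i ≠ b) ∧
      ι ⟨0, hm⟩ = c := by
  refine ⟨Equiv.swap (⟨0, by omega⟩ : Fin r) c ⟨m, hr⟩,
    fun i => Equiv.swap (⟨0, by omega⟩ : Fin r) c ⟨i.val, by have := i.2; omega⟩, ?_, ?_, ?_⟩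
  · intro i j hij
    have h := congrArg Fin.val ((Equiv.swap (⟨0, by omega⟩ : Fin r) c).injective hij)
    exact Fin.ext h
  · intro i h
    have h' := congrArg Fin.val ((Equiv.swap (⟨0, by omega⟩ : Fin r) c).injective h)
    have := i.2
    simp only at h'
    omega
  · exact Equiv.swap_apply_left _ _

/-- If `0 < m < r` then some column `b` of `E : N × r` lies in the Krylov span
`span {(Zᵀ)^j *ᵥ (Eᵀ (ι i)) | i : Fin m, j : ℕ}` of `m` other columns `ι` (`ι` injective,
avoiding `b`): take `ι 0` a column attaining the largest row index of a nonzero entry of `E`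
(`hclR_phi_top_column`); the `m`-ary `hclR_column_absorbed`. -/
theorem hclR_phi_column_absorbed {N r m : ℕ} (E : Matrix (Fin N) (Fin r) ℂ) (hm : 0 < m)
    (hr : m < r) :
    ∃ (b : Fin r) (ι : Fin m → Fin r), Function.Injective ι ∧ (∀ i : Fin m, ι i ≠ b) ∧
    (Eᵀ b) ∈ Submodule.span ℂ {w : Fin N → ℂ | ∃ (i : Fin m) (j : ℕ),
    w = ((Matrix.of fun i j : Fin N => if (i : ℕ) = (j : ℕ) + 1 then (1 : ℂ) else 0)ᵀ ^ j) *ᵥ (Eᵀ (ι i))} := by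
  obtain ⟨c, hc⟩ := hclR_phi_top_column E ⟨0, by omega⟩
  obtain ⟨b, ι, hι, hιb, hι0⟩ := hclR_phi_fin_avoiding hm hr c
  refine ⟨b, ι, hι, hιb, Submodule.span_mono ?_ (hc b)⟩
  rintro _ ⟨j, rfl⟩
  exact ⟨⟨0, hm⟩, j, by rw [hι0]⟩

-- the registered binders `H`, `X₀`, `hF` etc. are named inside the `∀`
set_option linter.unusedVariables false in
/-- **Reduction of the G-const dual law to PHI-INJ(p)** (general `p`).  PHI-INJ(p): in a
nonsingular `(2p-1)`-column design of a `p`-generator class, the twisted evaluations of test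
matrices on the frame cover the twisted evaluations of every vector of the frame's Krylov span
(primal form: a class member killing the frame kills its Krylov span).  Conclusion: the registered
`stub_gconstDualLaw` (`r ≤ 2p`; the proof in fact gives `r ≤ 2p - 1`, sharp by the W-family). -/
theorem hclR_gconstDualLaw_of_phiInj :
    (∀ (N p : ℕ) (G₀ : Matrix (Fin N) (Fin p) ℂ) (E F : Matrix (Fin N) (Fin (2 * p - 1)) ℂ)
      (M : Matrix (Fin N) (Fin N) ℂ) (H : Matrix (Fin N) (Fin p) ℂ)
      (X₀ : Matrix (Fin (2 * p - 1)) (Fin (2 * p - 1)) ℂ),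
      E.rank = 2 * p - 1 → F.rank = 2 * p - 1 →
      (∀ Λ : Matrix (Fin N) (Fin (2 * p - 1)) ℂ,
        (∀ k : Fin p,
          (∑ c : Fin (2 * p - 1),
            (∑ j : Fin N,
              (((∑ i : Fin N, G₀ i k •
                  (Matrix.of fun i j : Fin N => if (i : ℕ) = (j : ℕ) + 1 then (1 : ℂ) else 0)ᵀ ^ (i : ℕ))
                *ᵥ (Λᵀ c)) j) •
              (Matrix.of fun i j : Fin N => if (i : ℕ) = (j : ℕ) + 1 then (1 : ℂ) else 0)ᵀ ^ (j : ℕ))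
            *ᵥ (Eᵀ c)) = 0) →
        Λᵀ * F = 0) →
      M - (Matrix.of fun i j : Fin N => if (i : ℕ) = (j : ℕ) + 1 then (1 : ℂ) else 0) * M *
          (Matrix.of fun i j : Fin N => if (i : ℕ) = (j : ℕ) + 1 then (1 : ℂ) else 0)ᵀ = G₀ * Hᵀ →
      M * E = F * X₀ → M.det ≠ 0 →
      ∀ v : Fin N → ℂ, v ∈ Submodule.span ℂ {w : Fin N → ℂ | ∃ (c : Fin (2 * p - 1)) (j : ℕ),
        w = ((Matrix.of fun i j : Fin N => if (i : ℕ) = (j : ℕ) + 1 then (1 : ℂ) else 0)ᵀ ^ j) *ᵥ (Eᵀ c)} →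
      ∀ μ : Fin N → ℂ, ∃ Λ : Matrix (Fin N) (Fin (2 * p - 1)) ℂ, ∀ k : Fin p,
        (∑ c : Fin (2 * p - 1),
          (∑ j : Fin N,
            (((∑ i : Fin N, G₀ i k •
                (Matrix.of fun i j : Fin N => if (i : ℕ) = (j : ℕ) + 1 then (1 : ℂ) else 0)ᵀ ^ (i : ℕ))
              *ᵥ (Λᵀ c)) j) •
            (Matrix.of fun i j : Fin N => if (i : ℕ) = (j : ℕ) + 1 then (1 : ℂ) else 0)ᵀ ^ (j : ℕ))
          *ᵥ (Eᵀ c)) =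
        (∑ j : Fin N,
          (((∑ i : Fin N, G₀ i k •
              (Matrix.of fun i j : Fin N => if (i : ℕ) = (j : ℕ) + 1 then (1 : ℂ) else 0)ᵀ ^ (i : ℕ))
            *ᵥ μ) j) •
          (Matrix.of fun i j : Fin N => if (i : ℕ) = (j : ℕ) + 1 then (1 : ℂ) else 0)ᵀ ^ (j : ℕ))
        *ᵥ v) →
    ∀ (r N p : ℕ) (G₀ : Matrix (Fin N) (Fin p) ℂ) (E F : Matrix (Fin N) (Fin r) ℂ)
      (M : Matrix (Fin N) (Fin N) ℂ) (H : Matrix (Fin N) (Fin p) ℂ) (X₀ : Matrix (Fin r) (Fin r) ℂ),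
      E.rank = r → F.rank = r →
      (∀ Λ : Matrix (Fin N) (Fin r) ℂ,
        (∀ k : Fin p,
          (∑ c : Fin r,
            (∑ j : Fin N,
              (((∑ i : Fin N, G₀ i k •
                  (Matrix.of fun i j : Fin N => if (i : ℕ) = (j : ℕ) + 1 then (1 : ℂ) else 0)ᵀ ^ (i : ℕ))
                *ᵥ (Λᵀ c)) j) •
              (Matrix.of fun i j : Fin N => if (i : ℕ) = (j : ℕ) + 1 then (1 : ℂ) else 0)ᵀ ^ (j : ℕ))
            *ᵥ (Eᵀ c)) = 0) →
        Λᵀ * F = 0) →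
      M - (Matrix.of fun i j : Fin N => if (i : ℕ) = (j : ℕ) + 1 then (1 : ℂ) else 0) * M *
          (Matrix.of fun i j : Fin N => if (i : ℕ) = (j : ℕ) + 1 then (1 : ℂ) else 0)ᵀ = G₀ * Hᵀ →
      M * E = F * X₀ →
      M.det ≠ 0 →
      r ≤ 2 * p := by
  intro hPHI r N p G₀ E F M H X₀ hE hF hann hM hME hdet
  by_contra hr
  rcases Nat.eq_zero_or_pos p with hp | hp
  · -- `p = 0`: the annihilator hypothesis is unconditional, so `F = 0`
    subst hp
    have hF0 : F = 0 := by
      ext n₀ a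
      have hΛF := hann (Matrix.of fun (n : Fin N) (c : Fin r) =>
          if c = a then (Pi.single n₀ 1 : Fin N → ℂ) n else 0) (fun k => k.elim0)
      have h := congrFun (congrFun hΛF a) a
      simpa [Matrix.mul_apply, Pi.single_apply] using h
    have h0 : F.rank = 0 := by rw [hF0, Matrix.rank_zero]
    omega
  · -- `1 ≤ p`: reduce to PHI-INJ(p) on the `2p - 1` columns `ι` absorbing a further column `b`
    have hm : 0 < 2 * p - 1 := by omega
    have hmr : 2 * p - 1 < r := by omega
    obtain ⟨b, ι, hι, hιb, hb⟩ := hclR_phi_column_absorbed E hm hmr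
    -- (i) the `2p - 1` columns `ι` form a rank-`(2p-1)` frame
    have hcols : LinearIndependent ℂ E.col := by
      rw [linearIndependent_iff_card_eq_finrank_span, Fintype.card_fin, Set.finrank,
        ← Matrix.rank_eq_finrank_span_cols, hE]
    have hEm : (E.submatrix id ι).rank = 2 * p - 1 := by
      have hli : LinearIndependent ℂ (E.submatrix id ι).col := hcols.comp ι hι
      have h := linearIndependent_iff_card_eq_finrank_span.mp hli
      rw [Fintype.card_fin, Set.finrank, ← Matrix.rank_eq_finrank_span_cols] at h
      exact h.symm
    -- (ii) so does its image under the invertible `M`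
    have hFm : (M * E.submatrix id ι).rank = 2 * p - 1 := by
      rw [Matrix.rank_mul_eq_right_of_isUnit_det M _ (isUnit_iff_ne_zero.mpr hdet), hEm]
    -- `M` maps the sub-frame into the span of `F`
    have hFmX : M * E.submatrix id ι = F * X₀.submatrix id ι := by
      ext n i
      have h := congrFun (congrFun hME n) (ι i)
      simpa only [Matrix.mul_apply, Matrix.submatrix_apply, id] using h
    -- (iii) the annihilator hypothesis descends to the sub-design (extend test matrices by zero)
    have hannm : ∀ Λ : Matrix (Fin N) (Fin (2 * p - 1)) ℂ, (∀ k : Fin p,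
        (∑ c : Fin (2 * p - 1), (∑ j : Fin N,
        (((∑ i : Fin N, G₀ i k •
            (Matrix.of fun i j : Fin N => if (i : ℕ) = (j : ℕ) + 1 then (1 : ℂ) else 0)ᵀ ^ (i : ℕ)) *ᵥ
          (Λᵀ c)) j) •
          (Matrix.of fun i j : Fin N => if (i : ℕ) = (j : ℕ) + 1 then (1 : ℂ) else 0)ᵀ ^ (j : ℕ)) *ᵥ
        ((E.submatrix id ι)ᵀ c)) = 0) → Λᵀ * (M * E.submatrix id ι) = 0 := by
      intro Λ hΛ
      have hΛF : (Matrix.of fun (n : Fin N) (c : Fin r) =>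
          ∑ i : Fin (2 * p - 1), if ι i = c then Λ n i else 0)ᵀ * F = 0 := by
        apply hann
        intro k
        rw [hclR_phi_sum_extend_fin]
        exact hΛ k
      have hΛF' : Λᵀ * F = 0 := by
        ext i a
        have h := congrFun (congrFun hΛF (ι i)) a
        simpa [Matrix.mul_apply, hι.eq_iff] using h
      rw [hFmX, ← Matrix.mul_assoc, hΛF', Matrix.zero_mul]
    -- the absorbed column lies in the Krylov span of the sub-frame
    have hbm : (Eᵀ b) ∈ Submodule.span ℂ {w : Fin N → ℂ | ∃ (c : Fin (2 * p - 1)) (j : ℕ),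
        w = ((Matrix.of fun i j : Fin N => if (i : ℕ) = (j : ℕ) + 1 then (1 : ℂ) else 0)ᵀ ^ j) *ᵥ
          ((E.submatrix id ι)ᵀ c)} := hb
    have key := hPHI N p G₀ (E.submatrix id ι) (M * E.submatrix id ι) M H 1 hEm hFm hannm hM
      (Matrix.mul_one _).symm hdet (Eᵀ b) hbm
    -- (iv) every row functional kills `F`, so `F = 0`
    have hF0 : F = 0 := by
      ext n₀ a
      obtain ⟨Λ, hΛ⟩ := key (Pi.single n₀ 1)
      have hΛF : ((Matrix.of fun (n : Fin N) (c : Fin r) =>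
            ∑ i : Fin (2 * p - 1), if ι i = c then Λ n i else 0) +
          (Matrix.of fun (n : Fin N) (c : Fin r) =>
            if c = b then (-(Pi.single n₀ 1 : Fin N → ℂ)) n else 0))ᵀ * F = 0 := by
        apply hann
        intro k
        have hsplit : ∀ (P Q : Matrix (Fin N) (Fin r) ℂ) (c : Fin r), (P + Q)ᵀ c = Pᵀ c + Qᵀ c :=
          fun P Q c => rfl
        simp only [hsplit, hclR_phi_T_add, Finset.sum_add_distrib]
        rw [hclR_phi_sum_extend_fin, hclR_phi_sum_single, hclR_phi_T_neg, ← sub_eq_add_neg,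
          sub_eq_zero]
        exact hΛ k
      have h := congrFun (congrFun hΛF b) a
      simpa [Matrix.mul_apply, hιb, Pi.single_apply] using h
    have h0 : F.rank = 0 := by rw [hF0, Matrix.rank_zero]
    omega

end Summit.MatrixMultiplication.MatrixMultiplication.Theorems
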